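import Summits.AtomisticToContinuum.Crystallization.Theses.ReggeStarCoercivity
import Literature.Geometry.DiscreteGeometry.TwoShellPatterns

/-!
# drefute evidence — a complete proof of STUB 2 `stub_twoShellGoodStarGood` of line `separation-padding-transfer`
(crux `ReggeStarCoercivity.StarCoercivity`, stmt-AtomisticToContinuum-13600)

Two-shell good (`IsTwoShellGood (1/20) (47/50) 1 x i`) ⇒ star good (the crux's free-site predicate), for injective `x`.
Pattern arithmetic: with `(a, A, P, f)` from the hypothesis (`a ∈ [47/50, 1]`), a particle `j ≠ i` within `6/5 ≤ 3a/2` of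
`x i` is `f v` for some `v ∈ P`; `‖v‖ = √2` would put it at distance `≥ a(√2 − 1/20) ≥ 1.2823 > 6/5`, so `v` lies in the
first shell `K`; conversely every `v ∈ K` has its particle within `21a/20 ≤ 1.05 < 6/5`.  Hence `w = A v ↦ a⁻¹ • (x (f v) − x i)`
is a bijection `K.image A ≃ shell` moving each point by `a⁻¹ · (a/20) = 1/20`.

Candidate proof for the lead (refuter may not land positive statements); restates the stub verbatim at the end
(`stub_twoShellGoodStarGood_proof`).
-/

noncomputable section

open scoped BigOperators Classical
open Literature.Geometry.DiscreteGeometry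

namespace Summit.AtomisticToContinuum.Crystallization.Cruxes.StarCoercivity.SeparationPaddingTransfer.Drefute

/-- Euclidean `3`-space. -/
local notation "E3" => EuclideanSpace ℝ (Fin 3)

/-- The fcc second-shell integer vectors all have squared norm `4`. -/
theorem sqNormInt_fccSecondShellInt : ∀ w ∈ fccSecondShellInt, sqNormInt w = ((4 : ℕ) : ℤ) := by decide

/-- The hcp second-shell integer vectors all have squared norm `36`. -/
theorem sqNormInt_hcpSecondShellInt : ∀ w ∈ hcpSecondShellInt, sqNormInt w = ((36 : ℕ) : ℤ) := by decide

/-- A point of the fcc two-shell pattern outside the first shell has norm `√2`. -/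
theorem norm_of_mem_fccTwoShell_not_mem {v : E3} (hv : v ∈ fccTwoShellPattern) (hvK : v ∉ fccKissingPattern) :
    ‖v‖ = Real.sqrt 2 := by
  unfold fccTwoShellPattern scaledPattern at hv
  unfold fccKissingPattern scaledPattern at hvK
  obtain ⟨w, hw, rfl⟩ := Finset.mem_image.1 hv
  rcases Finset.mem_union.1 hw with hw1 | hw2
  · exact absurd (Finset.mem_image_of_mem _ hw1) hvK
  · have hmem : (Real.sqrt ((2 : ℕ) : ℝ))⁻¹ • intVec w ∈ scaledPattern fccSecondShellInt 2 :=
      Finset.mem_image_of_mem _ hw2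
    obtain ⟨w', hw', h⟩ := norm_of_mem_scaledPattern two_ne_zero hmem
    rw [h, sqNormInt_fccSecondShellInt w' hw']
    norm_num

/-- A point of the hcp two-shell pattern outside the first shell has norm `√2`. -/
theorem norm_of_mem_hcpTwoShell_not_mem {v : E3} (hv : v ∈ hcpTwoShellPattern) (hvK : v ∉ hcpKissingPattern) :
    ‖v‖ = Real.sqrt 2 := by
  unfold hcpTwoShellPattern scaledPattern at hv
  unfold hcpKissingPattern scaledPattern at hvK
  obtain ⟨w, hw, rfl⟩ := Finset.mem_image.1 hv
  rcases Finset.mem_union.1 hw with hw1 | hw2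
  · exact absurd (Finset.mem_image_of_mem _ hw1) hvK
  · have hmem : (Real.sqrt ((18 : ℕ) : ℝ))⁻¹ • intVec w ∈ scaledPattern hcpSecondShellInt 18 :=
      Finset.mem_image_of_mem _ hw2
    obtain ⟨w', hw', h⟩ := norm_of_mem_scaledPattern (by norm_num) hmem
    rw [h, sqNormInt_hcpSecondShellInt w' hw']
    norm_num

/-- `√2 > 1.4142`. -/
theorem sqrt_two_gt : (1.4142 : ℝ) < Real.sqrt 2 := by
  rw [show (1.4142 : ℝ) = Real.sqrt (1.4142 ^ 2) by rw [Real.sqrt_sq]; norm_num]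
  exact Real.sqrt_lt_sqrt (by norm_num) (by norm_num)

/-- **The transfer lemma.**  A two-way `a/20`-match (`a ∈ [47/50, 1]`) of the `3a/2`-neighbourhood of `x i` with `A(P)`,
`K ⊆ P`, `K` a `1`-separated subset of the unit sphere and `P ∖ K` on the sphere of radius `√2`, makes the crux's
recentred `a⁻¹`-rescaled `6/5`-shell of `i` `1/20`-close to `K` (with the same isometry `A`).  Neither injectivity of `x`
nor injectivity of the assignment `f` is needed. -/
theorem shellCloseTo_of_twoShellMatch {N : ℕ} {x : Fin N → E3} {i : Fin N}
    {a : ℝ} (ha1 : 47 / 50 ≤ a) (ha2 : a ≤ 1) (A : E3 →ₗᵢ[ℝ] E3) (K P : Finset E3) (f : E3 → Fin N)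
    (hKP : K ⊆ P) (hK1 : ∀ v ∈ K, ‖v‖ = 1) (hKsep : ∀ v ∈ K, ∀ w ∈ K, v ≠ w → 1 ≤ dist v w)
    (hPK : ∀ v ∈ P, v ∉ K → ‖v‖ = Real.sqrt 2)
    (hf : ∀ v ∈ P, f v ≠ i ∧ dist (x (f v)) (x i + a • A v) ≤ 1 / 20 * a)
    (hsurj : ∀ j : Fin N, j ≠ i → dist (x j) (x i) ≤ 3 / 2 * a → ∃ v ∈ P, f v = j)
    [DecidablePred fun j : Fin N => j ≠ i ∧ dist (x i) (x j) ≤ 6 / 5] :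
    ShellCloseTo (1 / 20) ((Finset.univ.filter fun j : Fin N => j ≠ i ∧ dist (x i) (x j) ≤ 6 / 5).image
      fun j => a⁻¹ • (x j - x i)) K := by
  have ha0 : 0 < a := by linarith
  have hfar : (6 / 5 : ℝ) < a * (Real.sqrt 2 - 1 / 20) := by nlinarith [sqrt_two_gt]
  set S := Finset.univ.filter fun j : Fin N => j ≠ i ∧ dist (x i) (x j) ≤ 6 / 5 with hS
  set φ : Fin N → E3 := fun j => a⁻¹ • (x j - x i) with hφ
  -- the displaced pattern point of `v` sits at distance `a‖v‖` from `x i`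
  have hcentre : ∀ v : E3, dist (x i + a • A v) (x i) = a * ‖v‖ := fun v => by
    rw [dist_eq_norm, add_sub_cancel_left, norm_smul, Real.norm_of_nonneg ha0.le, A.norm_map]
  -- (1) first-shell pattern points have their particles in the `6/5`-shell
  have hKS : ∀ v ∈ K, f v ∈ S := by
    intro v hv
    have hvP := hKP hv
    refine Finset.mem_filter.2 ⟨Finset.mem_univ _, (hf v hvP).1, ?_⟩
    have h1 := dist_triangle (x (f v)) (x i + a • A v) (x i)
    rw [hcentre v, hK1 v hv, mul_one] at h1
    rw [dist_comm]
    linarith [(hf v hvP).2]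
  -- (2) every particle of the `6/5`-shell is the particle of a first-shell pattern point
  have hSK : ∀ j ∈ S, ∃ v ∈ K, f v = j := by
    intro j hj
    obtain ⟨-, hji, hdist⟩ := Finset.mem_filter.1 hj
    have hd' : dist (x j) (x i) ≤ 3 / 2 * a := by rw [dist_comm]; linarith
    obtain ⟨v, hvP, hfv⟩ := hsurj j hji hd'
    refine ⟨v, ?_, hfv⟩
    by_contra hvK
    have hn := hPK v hvP hvK
    have h1 := dist_triangle (x i + a • A v) (x (f v)) (x i)
    rw [hcentre v, hn, dist_comm (x i + a • A v) (x (f v)), hfv, dist_comm (x j) (x i)] at h1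
    have h3 := (hf v hvP).2
    rw [hfv] at h3
    linarith
  -- preimages under `A` of the points of `K.image A`
  have hpre : ∀ w : ↥(K.image A), ∃ v, v ∈ K ∧ A v = (w : E3) := fun w => Finset.mem_image.1 w.2
  choose pre hpreK hpreA using hpre
  have hgmem : ∀ w : ↥(K.image A), φ (f (pre w)) ∈ S.image φ := fun w =>
    Finset.mem_image_of_mem φ (hKS _ (hpreK w))
  let g : ↥(K.image A) → ↥(S.image φ) := fun w => ⟨φ (f (pre w)), hgmem w⟩
  have hg_inj : Function.Injective g := by
    intro w₁ w₂ h
    have h' : φ (f (pre w₁)) = φ (f (pre w₂)) := congrArg Subtype.val h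
    have h'' : x (f (pre w₁)) - x i = x (f (pre w₂)) - x i :=
      smul_right_injective E3 (inv_ne_zero ha0.ne') h'
    have heq : x (f (pre w₁)) = x (f (pre w₂)) := sub_left_inj.1 h''
    -- no injectivity of `x` needed: both pattern points are within `a/20` of the same particle, and `K` is `1`-separated
    have h4 : pre w₁ = pre w₂ := by
      by_contra hne
      have hsep1 := hKsep _ (hpreK w₁) _ (hpreK w₂) hne
      have hd : dist (x i + a • A (pre w₁)) (x i + a • A (pre w₂)) = a * dist (pre w₁) (pre w₂) := by
        rw [dist_eq_norm, add_sub_add_left_eq_sub, ← smul_sub, norm_smul, Real.norm_of_nonneg ha0.le, ← map_sub,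
          A.norm_map, dist_eq_norm]
      have htri := dist_triangle (x i + a • A (pre w₁)) (x (f (pre w₁))) (x i + a • A (pre w₂))
      have k1 := (hf (pre w₁) (hKP (hpreK w₁))).2
      have k2 := (hf (pre w₂) (hKP (hpreK w₂))).2
      rw [dist_comm] at k1
      rw [heq] at htri k1
      rw [hd] at htri
      have h10 : a * dist (pre w₁) (pre w₂) ≤ a * (1 / 10) := by linarith
      have h11 : dist (pre w₁) (pre w₂) ≤ 1 / 10 := le_of_mul_le_mul_left h10 ha0
      linarith
    apply Subtype.ext
    rw [← hpreA w₁, ← hpreA w₂, h4]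
  have hg_surj : Function.Surjective g := by
    intro t
    obtain ⟨j, hj, hjt⟩ := Finset.mem_image.1 t.2
    obtain ⟨v, hvK, hfv⟩ := hSK j hj
    refine ⟨⟨A v, Finset.mem_image_of_mem A hvK⟩, ?_⟩
    apply Subtype.ext
    have hv : pre ⟨A v, Finset.mem_image_of_mem A hvK⟩ = v := A.injective (hpreA _)
    show φ (f (pre ⟨A v, Finset.mem_image_of_mem A hvK⟩)) = t
    rw [hv, hfv, hjt]
  let e : ↥(K.image A) ≃ ↥(S.image φ) := Equiv.ofBijective g ⟨hg_inj, hg_surj⟩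
  refine ⟨A, e.symm, fun t => ?_⟩
  obtain ⟨w, rfl⟩ := e.surjective t
  rw [Equiv.symm_apply_apply]
  show dist (φ (f (pre w))) (w : E3) ≤ 1 / 20
  have key := (hf (pre w) (hKP (hpreK w))).2
  have hid : (w : E3) = a⁻¹ • (a • A (pre w)) := by
    rw [smul_smul, inv_mul_cancel₀ ha0.ne', one_smul, hpreA w]
  rw [hid, hφ, dist_smul₀, norm_inv, Real.norm_of_nonneg ha0.le]
  have hdd : dist (x (f (pre w)) - x i) (a • A (pre w)) = dist (x (f (pre w))) (x i + a • A (pre w)) := by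
    rw [dist_eq_norm, dist_eq_norm, sub_sub]
  rw [hdd]
  calc a⁻¹ * dist (x (f (pre w))) (x i + a • A (pre w)) ≤ a⁻¹ * (1 / 20 * a) :=
        mul_le_mul_of_nonneg_left key (inv_nonneg.2 ha0.le)
    _ = 1 / 20 := by field_simp

/-- **STUB 2 proved, WITHOUT the injectivity hypothesis** (hypothesis mutation: `Function.Injective x` is unnecessary):
a two-shell-good particle (`IsTwoShellGood (1/20) (47/50) 1 x i`) is star-good in the sense of the crux, at the same scale
`a ∈ [47/50, 1] ⊆ [9/10, 11/10]` and with the same isometry. -/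
theorem twoShellGoodStarGood {N : ℕ} (x : Fin N → E3) (i : Fin N)
    (h : IsTwoShellGood (1 / 20) (47 / 50) 1 x i) :
    ∃ a : ℝ, 9 / 10 ≤ a ∧ a ≤ 11 / 10 ∧
      (ShellCloseTo (1 / 20) ((Finset.univ.filter fun j : Fin N => j ≠ i ∧ dist (x i) (x j) ≤ 6 / 5).image
          fun j => a⁻¹ • (x j - x i)) fccKissingPattern ∨
        ShellCloseTo (1 / 20) ((Finset.univ.filter fun j : Fin N => j ≠ i ∧ dist (x i) (x j) ≤ 6 / 5).image
          fun j => a⁻¹ • (x j - x i)) hcpKissingPattern) := by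
  obtain ⟨a, ha1, ha2, A, P, f, hP, hf, -, hsurj⟩ := h
  refine ⟨a, by linarith, by linarith, ?_⟩
  rcases hP with rfl | rfl
  · exact Or.inl (shellCloseTo_of_twoShellMatch ha1 ha2 A fccKissingPattern fccTwoShellPattern f
      fccKissingPattern_subset (fun v hv => norm_eq_one_of_mem_fccKissingPattern hv)
      (fun v hv w hw hvw => one_le_dist_of_mem_fccKissingPattern hv hw hvw)
      (fun v hv hvK => norm_of_mem_fccTwoShell_not_mem hv hvK) hf hsurj)
  · exact Or.inr (shellCloseTo_of_twoShellMatch ha1 ha2 A hcpKissingPattern hcpTwoShellPattern f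
      hcpKissingPattern_subset (fun v hv => norm_eq_one_of_mem_hcpKissingPattern hv)
      (fun v hv w hw hvw => one_le_dist_of_mem_hcpKissingPattern hv hw hvw)
      (fun v hv hvK => norm_of_mem_hcpTwoShell_not_mem hv hvK) hf hsurj)

/-- The registered stub `stub_twoShellGoodStarGood` of `Lines/separation-padding-transfer.lean`, VERBATIM, proved. -/
theorem stub_twoShellGoodStarGood_proof : ∀ (N : ℕ) (x : Fin N → EuclideanSpace ℝ (Fin 3)) (i : Fin N), Function.Injective x → Literature.Geometry.DiscreteGeometry.IsTwoShellGood (1 / 20) (47 / 50) 1 x i → ∃ a : ℝ, 9 / 10 ≤ a ∧ a ≤ 11 / 10 ∧ (Literature.Geometry.DiscreteGeometry.ShellCloseTo (1 / 20) ((Finset.univ.filter fun j : Fin N => j ≠ i ∧ dist (x i) (x j) ≤ 6 / 5).image fun j => a⁻¹ • (x j - x i)) Literature.Geometry.DiscreteGeometry.fccKissingPattern ∨ Literature.Geometry.DiscreteGeometry.ShellCloseTo (1 / 20) ((Finset.univ.filter fun j : Fin N => j ≠ i ∧ dist (x i) (x j) ≤ 6 / 5).image fun j => a⁻¹ • (x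 j - x i)) Literature.Geometry.DiscreteGeometry.hcpKissingPattern) :=
  fun _ x i _ h => twoShellGoodStarGood x i h

end Summit.AtomisticToContinuum.Crystallization.Cruxes.StarCoercivity.SeparationPaddingTransfer.Drefute

end
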